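import Literature.AlgebraicGeometry.ModuliOfAbelianVarieties.SiegelCMSpecialPairPeriodIso
import Literature.NumberTheory.ComplexMultiplication.CMTypeRiemannForm
import HarnessLib

/-!
# The polarisation of a CM special pair on the Siegel datum is a trace form:
# `ψ_δ(act(x)·v₀, act(y)·v₀) = Tr_{F/ℚ}(ζ x ȳ)`, `ζ̄ = −ζ`, and its sign on `X^±` ([Shimura 1998] §6.2 Thm. 4; [Deligne 1971] 4.18)

Topic `AlgebraicGeometry/ModuliOfAbelianVarieties`; namespace
`Literature.AlgebraicGeometry.ModuliOfAbelianVarieties.CMStructure`.  THEOREMS ONLY (no definition, no named fact, no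
instance, no `sorry`; net Literature debt **0**).  Sequel of ★ R60-33 `SiegelCMSpecialPairPeriodIso` (the period
isomorphism `e : (ℝ^{2g}, J, act) ≅ (∏ᵢ ℂ^{Φᵢ}, √−1, F)`) and ★ `CMTypeRiemannForm` (Shimura's form `E_ζ` on `ℂ^Φ`,
`E_ζ(u(a), u(b)) = Tr(ζ a b̄)`).  Cell hodgecm-mathlib (D-0151), banked GENERIC leaf toward fan-B row I-7 (#60) `SiegelS1`
(director g6 RULING s86 (2)(b); A-p05's MUMFORD-LINE-SPEC: the polarisation side of the moduli reading of a special
point `[J, a]` — the TYPE-`δ` clause of Mumford's `A_{g,δ,N}`).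

WHAT IS PROVED.  `c` a CM structure of type `δ` ([Deligne1971TravauxShimura] 4.18: `act : F = ∏ᵢ Kᵢ ↪ End_ℚ(ℚ^{2g})`,
`ψ_δ(x·v, w) = ψ_δ(v, x̄·w)`), `ψ_δ(v, w) = v ⬝ᵥ (E_δ *ᵥ w)` the type-`δ` form (★ `typeFormOver δ`).
* §1 `E_δᵀ = −E_δ`, `ψ_δ(w, v) = −ψ_δ(v, w)`.
* §2 `exists_skew_trace_eq_typeForm` — for every `v₀ ∈ ℚ^{2g}` there is `ζ ∈ F`, `ζ̄ = −ζ`, with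
  `ψ_δ(act(x)·v₀, act(y)·v₀) = Σᵢ Tr_{Kᵢ/ℚ}(ζᵢ xᵢ ȳᵢ)` (`B(zx, y) = B(x, z̄y)` ⇒ `B(x, y) = B(1, x̄y)`, a linear functional on
  `F`, represented through the non-degenerate trace forms of the `Kᵢ/ℚ` — Mathlib `traceForm_nondegenerate`; skewness from
  alternation); `skew_trace_unique` — `ζ` is unique.
* §3 `dotProduct_typeFormOver_mulVec_eq_sum_riemannForm` — for a chart `e : ℝ^{2g} ≃ₗ[ℝ] ∏ᵢ ℂ^{Φᵢ}` normalised at a cyclic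
  `v₀` (`e(act(x)·v₀) = Ψ(x)`, ★ R60-33): `ψ_δ(v, w) = Σᵢ E_{ζᵢ}((e v)ᵢ, (e w)ᵢ)` for ALL real `v, w` (agreement on the
  rational structure, which spans; ★ `riemannForm_cmEmbedding`).
* §4 `im_embedding_neg_of_mem_C0` / `neg_im_pos_of_mem_C0` / `im_embedding_pos_of_neg_mem_C0` — if moreover `e(J·v) = √−1·e(v)`:
  `J ∈ X⁺ = C0 δ` (Lange: `ᵗJ E_δ ≻ 0`) ⇒ `Im φ(ζᵢ) < 0`, i.e. `(Kᵢ, Φᵢ; −ζᵢ)` is a Riemann-form datum in Shimura's sense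
  (`Im(−ζᵢ)^φ > 0`); `−J ∈ C0 δ` ⇒ `Im φ(ζᵢ) > 0`.  (CONVENTIONS, recorded once: Lange's `E(J·, ·) ≻ 0` is Shimura's
  `E(·, √−1·) ≻ 0` for `−E`, since `E(√−1 z, w) = −E(z, √−1 w)` for a `(1,1)`-form.)
* §5 HEAD `IsSpecial.exists_periodIso_riemannForm` — for a special pair `(c, J, Φ)`: `∃ e v₀ ζ` with (a) `e ∘ J = √−1·e`,
  (b) `e ∘ act(x) = Ψ(x)·e`, (c) `e(act(x)·v₀) = Ψ(x)`, `x ↦ act(x)·v₀` bijective, (d) `ζ̄ = −ζ`,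
  `ψ_δ = Σᵢ E_{ζᵢ} ∘ e`, (e) the sign on `X^±` — the polarised special point `(ℝ^{2g}, J, ψ_δ, act ⊃ ℚ^{2g})` IS the CM
  datum `(∏ᵢ ℂ^{Φᵢ}, √−1, Σᵢ E_{ζᵢ}, F)` of [Shimura1998] §6.2 Thm. 4.
Nothing printed is asserted.  HC_CM is proved only modulo the 7 printed citations until rung 0 closes.

## References
* [Shimura1998] G. Shimura, *Abelian Varieties with Complex Multiplication and Modular Functions* (1998), §6.2 Thm. 4
  p. 45 and proof of Thm. 3 pp. 42–44 (`E(u(x), u(y)) = Tr_{F/ℚ}(ζ x y^ρ)`, `ζ^ρ = −ζ`, `Im ζ^{φ} > 0`).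
* [Deligne1971TravauxShimura] P. Deligne, *Travaux de Shimura*, Sém. Bourbaki 389 (1971), 4.18 p. 150.
* [MilneCM2006] J. S. Milne, *Complex Multiplication* (2006), Ch. I §2 (Riemann forms `Tr(ξ x ȳ)`), Ex. 2.9.
* [Lange2023AbelianVarietiesComplex] H. Lange, *Abelian Varieties over the Complex Numbers* (2023), §7.1.2 (7.1).
* [Milne2005ShimuraVarieties] J. S. Milne, *Introduction to Shimura varieties* (2005), §6 pp. 68–70, Ex. 12.4 (b).
* [GenestierNgo2020] A. Genestier, B. C. Ngô, *Lectures on Shimura varieties*, §1.2 (`E_δ = (0 D; −D 0)`).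
-/

set_option autoImplicit false

noncomputable section

open scoped Classical
open Matrix NumberField Module Function

namespace Literature.AlgebraicGeometry.ModuliOfAbelianVarieties

namespace CMStructure

open Literature.AlgebraicGeometry.Motives (CMType)
open Literature.NumberTheory.ComplexMultiplication (CMTypeLattice.cmEmbedding CMTypeLattice.cmEmbedding_apply
  CMTypeLattice.riemannForm CMTypeLattice.riemannForm_cmEmbedding CMTypeLattice.riemannForm_apply
  CMTypeLattice.riemannForm_swap CMTypeLattice.riemannForm_self_I_smul)

variable {g : ℕ} {δ : Fin g → ℕ} {ι : Type} [Fintype ι] [DecidableEq ι] {K : ι → Type} [∀ i, Field (K i)]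
  [∀ i, NumberField (K i)] [∀ i, IsCMField (K i)]

/-! ### §1. `ψ_δ` is alternating; the adjoint identity on `F`-translates of a vector -/

omit [Fintype ι] [DecidableEq ι] [∀ i, NumberField (K i)] [∀ i, IsCMField (K i)] in
/-- `E_δ` is skew over any commutative ring: `E_δᵀ = −E_δ`. [cite: GenestierNgo2020, §1.2] -/
theorem transpose_typeFormOver (δ : Fin g → ℕ) (R : Type) [CommRing R] :
    (typeFormOver δ R)ᵀ = -typeFormOver δ R := by
  rw [typeFormOver, ← Matrix.transpose_map, transpose_typeForm]
  ext i j
  simp only [Matrix.map_apply, Matrix.neg_apply, map_neg]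

omit [Fintype ι] [DecidableEq ι] [∀ i, NumberField (K i)] [∀ i, IsCMField (K i)] in
/-- `ψ_δ(w, v) = −ψ_δ(v, w)`: the type-`δ` form is alternating. [cite: GenestierNgo2020, §1.2] -/
theorem dotProduct_typeFormOver_mulVec_swap (R : Type) [CommRing R] (v w : Fin g ⊕ Fin g → R) :
    w ⬝ᵥ (typeFormOver δ R *ᵥ v) = -(v ⬝ᵥ (typeFormOver δ R *ᵥ w)) := by
  conv_rhs => rw [Matrix.dotProduct_mulVec, ← Matrix.mulVec_transpose, transpose_typeFormOver, Matrix.neg_mulVec,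
    neg_dotProduct, neg_neg, dotProduct_comm]

omit [Fintype ι] [DecidableEq ι] in
/-- Complex conjugation of a CM field as a `ℚ`-algebra automorphism (it fixes `ℚ`). [folklore] -/
private theorem exists_algEquiv_eq_complexConj (i : ι) :
    ∃ σ : K i ≃ₐ[ℚ] K i, ∀ a, σ a = IsCMField.complexConj (K i) a :=
  ⟨AlgEquiv.ofRingEquiv (f := (IsCMField.complexConj (K i)).toRingEquiv) fun q => by simp, fun _ => rfl⟩

omit [Fintype ι] [DecidableEq ι] in
/-- `Tr_{K/ℚ}(ā) = Tr_{K/ℚ}(a)`. [folklore] -/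
private theorem trace_complexConj (i : ι) (a : K i) :
    Algebra.trace ℚ (K i) (IsCMField.complexConj (K i) a) = Algebra.trace ℚ (K i) a := by
  obtain ⟨σ, hσ⟩ := exists_algEquiv_eq_complexConj (K := K) i
  rw [← hσ, Algebra.trace_eq_of_algEquiv]

omit [Fintype ι] [DecidableEq ι] [∀ i, NumberField (K i)] [∀ i, IsCMField (K i)] in
/-- A rational matrix acts on the real vector `w ⊗ 1` through its rational action (vector form of
`RingHom.map_mulVec`). [folklore] -/
private theorem map_mulVec_comp {n : Type} [Fintype n] (f : ℚ →+* ℝ) (M : Matrix n n ℚ) (w : n → ℚ) :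
    M.map f *ᵥ (f ∘ w) = f ∘ (M *ᵥ w) := by
  funext k
  exact (RingHom.map_mulVec f M w k).symm

/-! ### §2. `ψ_δ` pulled back to `F` along `x ↦ act(x)·v₀` is the trace form `Tr_{F/ℚ}(ζ x ȳ)`, `ζ̄ = −ζ` -/

/-- **THE POLARISATION OF A CM STRUCTURE IS A TRACE FORM.**  For a CM structure `c` of type `δ`
(★ `CMStructure`: `act : F = ∏ᵢ Kᵢ ↪ End_ℚ(ℚ^{2g})`, `ψ_δ`-self-adjoint for the CM involution:
`ψ_δ(x·v, w) = ψ_δ(v, x̄·w)`) and ANY vector `v₀ ∈ ℚ^{2g}`, there is `ζ = (ζᵢ) ∈ F` with `ζ̄ = −ζ` such that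
`ψ_δ(act(x)·v₀, act(y)·v₀) = Tr_{F/ℚ}(ζ x ȳ) = Σᵢ Tr_{Kᵢ/ℚ}(ζᵢ xᵢ ȳᵢ)` for all `x, y ∈ F`.  Proof: `B(x, y) = ψ_δ(x·v₀, y·v₀)`
satisfies `B(zx, y) = B(x, z̄y)`, so `B(x, y) = B(1, x̄y) = Λ(x̄y)` for the linear functional `Λ = B(1, ·)`, which is
`w ↦ Σᵢ Tr(ηᵢ wᵢ)` by the non-degeneracy of the trace forms of the separable extensions `Kᵢ/ℚ` (Mathlib
`traceForm_nondegenerate`); `ζ = η̄`; `ζ̄ = −ζ` because `ψ_δ` is alternating.  This is the Riemann form of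
[Shimura1998] §6.2 Thm. 4 («`E(u(x), u(y)) = Tr_{F/ℚ}(ζ x y^ρ)`, `ζ^ρ = −ζ`») read on the Siegel datum of
[Deligne1971TravauxShimura] 4.18 («`L` stable par l'involution définie par `ψ`»); [MilneCM2006] I Example 2.9.
[cite: Shimura1998, §6.2 Thm. 4, p. 45] [cite: Deligne1971TravauxShimura, 4.18 p. 150] [cite: MilneCM2006, Ch. I §2 Ex. 2.9] -/
theorem exists_skew_trace_eq_typeForm (c : CMStructure g δ ι K) (v₀ : Fin g ⊕ Fin g → ℚ) :
    ∃ ζ : Π i, K i, (∀ i, IsCMField.complexConj (K i) (ζ i) = -ζ i) ∧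
      ∀ x y : Π i, K i, c.act x v₀ ⬝ᵥ (typeFormOver δ ℚ *ᵥ c.act y v₀) =
        ∑ i, Algebra.trace ℚ (K i) (ζ i * x i * IsCMField.complexConj (K i) (y i)) := by
  -- the bilinear form `B(x, y) = ψ_δ(act x v₀, act y v₀)` on `F`
  obtain ⟨B, hB⟩ : ∃ B : (Π i, K i) → (Π i, K i) → ℚ,
      ∀ x y, B x y = c.act x v₀ ⬝ᵥ (typeFormOver δ ℚ *ᵥ c.act y v₀) := ⟨_, fun _ _ => rfl⟩
  -- the adjoint identity `B(zx, y) = B(x, z̄y)` and skewness `B(y, x) = −B(x, y)`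
  have hadj : ∀ z x y : Π i, K i, B (z * x) y = B x ((fun i => IsCMField.complexConj (K i) (z i)) * y) := by
    intro z x y
    rw [hB, hB, map_mul, map_mul, Module.End.mul_apply, Module.End.mul_apply]
    exact c.adjoint z (c.act x v₀) (c.act y v₀)
  have hskew : ∀ x y : Π i, K i, B y x = -B x y := fun x y => by
    rw [hB, hB]; exact dotProduct_typeFormOver_mulVec_swap ℚ _ _
  -- the linear functional `Λ = B(1, ·)`
  obtain ⟨Λ, hΛ⟩ : ∃ Λ : (Π i, K i) →ₗ[ℚ] ℚ, ∀ w, Λ w = B 1 w := by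
    refine ⟨{ toFun := fun w => B 1 w, map_add' := fun a b => ?_, map_smul' := fun r a => ?_ }, fun w => rfl⟩
    · simp only [hB, map_add, LinearMap.add_apply, Matrix.mulVec_add, dotProduct_add]
    · simp only [hB, map_smul, LinearMap.smul_apply, Matrix.mulVec_smul, dotProduct_smul, RingHom.id_apply]
  have hΛsum : ∀ w : Π i, K i, Λ w = ∑ i, Λ (Pi.single i (w i)) := fun w => by
    conv_lhs => rw [← Finset.univ_sum_single w]
    rw [map_sum]
  -- each restriction `Λ ∘ ιᵢ` is represented by `ηᵢ` through the trace form of `Kᵢ/ℚ`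
  have hrep : ∀ i, ∃ η : K i, ∀ w : K i, Algebra.trace ℚ (K i) (η * w) = Λ (Pi.single i w) := by
    intro i
    refine ⟨((Algebra.traceForm ℚ (K i)).toDual (traceForm_nondegenerate ℚ (K i))).symm
      (Λ ∘ₗ LinearMap.single ℚ K i), fun w => ?_⟩
    rw [← Algebra.traceForm_apply, LinearMap.BilinForm.apply_toDual_symm_apply, LinearMap.comp_apply,
      LinearMap.coe_single]
  choose η hη using hrep
  -- conjugation of an elementary vector
  have hconj_single : ∀ (i : ι) (w : K i),
      (fun j => IsCMField.complexConj (K j) (Pi.single (M := K) i w j)) = Pi.single i (IsCMField.complexConj (K i) w) := by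
    intro i w
    funext j
    exact Pi.apply_single (fun j => IsCMField.complexConj (K j)) (fun j => map_zero _) i w j
  -- skewness of `η`: `η̄ᵢ = −ηᵢ`
  have hηskew : ∀ i, IsCMField.complexConj (K i) (η i) = -η i := by
    intro i
    have hzero : ∀ w : K i, Algebra.trace ℚ (K i) ((IsCMField.complexConj (K i) (η i) + η i) * w) = 0 := by
      intro w
      have h1 : B (Pi.single i w) 1 = Algebra.trace ℚ (K i) (η i * IsCMField.complexConj (K i) w) := by
        have h := hadj (Pi.single i w) 1 1
        rw [mul_one, mul_one] at h
        rw [h, hconj_single, ← hΛ, ← hη]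
      have h2 : B 1 (Pi.single i w) = Algebra.trace ℚ (K i) (η i * w) := by rw [← hΛ, ← hη]
      have h3 := hskew (Pi.single i w) 1
      rw [h1, h2, ← trace_complexConj i (η i * IsCMField.complexConj (K i) w),
        map_mul (IsCMField.complexConj (K i)), IsCMField.complexConj_apply_apply] at h3
      rw [add_mul, map_add, h3, add_neg_cancel]
    have hsep := (traceForm_nondegenerate ℚ (K i)).1 (IsCMField.complexConj (K i) (η i) + η i) fun w => by
      rw [Algebra.traceForm_apply]; exact hzero w
    exact eq_neg_of_add_eq_zero_left hsep
  refine ⟨fun i => IsCMField.complexConj (K i) (η i), fun i => ?_, fun x y => ?_⟩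
  · show IsCMField.complexConj (K i) (IsCMField.complexConj (K i) (η i)) = -IsCMField.complexConj (K i) (η i)
    rw [IsCMField.complexConj_apply_apply, hηskew, neg_neg]
  · -- `B x y = B(x·1, y) = B(1, x̄y) = Λ(x̄y) = Σᵢ Tr(ηᵢ x̄ᵢ yᵢ) = Σᵢ Tr(η̄ᵢ xᵢ ȳᵢ)`
    have h := hadj x 1 y
    rw [mul_one] at h
    rw [← hB, h, ← hΛ, hΛsum]
    refine Finset.sum_congr rfl fun i _ => ?_
    show Λ (Pi.single i (IsCMField.complexConj (K i) (x i) * y i)) =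
      Algebra.trace ℚ (K i) (IsCMField.complexConj (K i) (η i) * x i * IsCMField.complexConj (K i) (y i))
    rw [← hη, ← trace_complexConj i (η i * _), map_mul (IsCMField.complexConj (K i)),
      map_mul (IsCMField.complexConj (K i)), IsCMField.complexConj_apply_apply, mul_assoc]

/-- **Uniqueness of `ζ`**: the trace-form element of `(c, v₀)` is unique (non-degeneracy of `Tr_{Kᵢ/ℚ}`, testing on
`x = ιᵢ w`, `y = 1`). [cite: Shimura1998, §6.2 Thm. 4, p. 45] -/
theorem skew_trace_unique (c : CMStructure g δ ι K) (v₀ : Fin g ⊕ Fin g → ℚ) {ζ ζ' : Π i, K i}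
    (hζ : ∀ x y : Π i, K i, c.act x v₀ ⬝ᵥ (typeFormOver δ ℚ *ᵥ c.act y v₀) =
        ∑ i, Algebra.trace ℚ (K i) (ζ i * x i * IsCMField.complexConj (K i) (y i)))
    (hζ' : ∀ x y : Π i, K i, c.act x v₀ ⬝ᵥ (typeFormOver δ ℚ *ᵥ c.act y v₀) =
        ∑ i, Algebra.trace ℚ (K i) (ζ' i * x i * IsCMField.complexConj (K i) (y i))) :
    ζ = ζ' := by
  funext i
  have hzero : ∀ w : K i, Algebra.trace ℚ (K i) ((ζ i - ζ' i) * w) = 0 := by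
    intro w
    have h := (hζ (Pi.single i w) 1).symm.trans (hζ' (Pi.single i w) 1)
    rw [Finset.sum_eq_single i (fun j _ hj => by rw [Pi.single_eq_of_ne hj, mul_zero, zero_mul, map_zero])
        (fun h => (h (Finset.mem_univ i)).elim),
      Finset.sum_eq_single i (fun j _ hj => by rw [Pi.single_eq_of_ne hj, mul_zero, zero_mul, map_zero])
        (fun h => (h (Finset.mem_univ i)).elim),
      Pi.single_eq_same, Pi.one_apply, map_one, mul_one, mul_one] at h
    rw [sub_mul, map_sub, h, sub_self]
  have hsep := (traceForm_nondegenerate ℚ (K i)).1 (ζ i - ζ' i) fun w => by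
    rw [Algebra.traceForm_apply]; exact hzero w
  exact sub_eq_zero.mp hsep

/-! ### §3. Under an `F`-equivariant chart `ψ_δ` is the sum of Shimura's forms `E_{ζᵢ}` on the factors `ℂ^{Φᵢ}` -/

omit [DecidableEq ι] in
/-- **`ψ_δ = Σᵢ E_{ζᵢ} ∘ e` — THE POLARISATION IN THE CM-TORUS CURRENCY.**  Let `e : ℝ^{2g} ≃ ∏ᵢ ℂ^{Φᵢ}` be an
`ℝ`-linear chart normalised at a cyclic vector `v₀` (`e(act(x)·v₀) = Ψ(x) = (φ(xᵢ))_{i,φ}`, ★ R60-33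
`exists_linearEquiv_cmEmbedding` / `IsSpecial.exists_periodIso` (c)) and `ζ` the trace-form element of `(c, v₀)` (§2).
Then for ALL real vectors `ψ_δ(v, w) = Σᵢ E_{ζᵢ}((e v)ᵢ, (e w)ᵢ)`, `E_ζ` Shimura's form ★ `CMTypeLattice.riemannForm`
(`E_ζ(u(a), u(b)) = Tr(ζ a b̄)`, ★ `riemannForm_cmEmbedding`): the two real bilinear forms agree on the rational
structure `act(F)·v₀ = ℚ^{2g}`, which spans `ℝ^{2g}`. [cite: Shimura1998, §6.2 Thm. 4, p. 45]
[cite: Deligne1971TravauxShimura, 4.18 p. 150] -/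
theorem dotProduct_typeFormOver_mulVec_eq_sum_riemannForm (c : CMStructure g δ ι K) (Φ : ∀ i, CMType (K i))
    (e : (Fin g ⊕ Fin g → ℝ) ≃ₗ[ℝ] (Π i, ((Φ i).1 → ℂ))) {v₀ : Fin g ⊕ Fin g → ℚ}
    (hv₀ : Function.Bijective fun x : Π i, K i => c.act x v₀)
    (he : ∀ x : Π i, K i, e ((algebraMap ℚ ℝ) ∘ (c.act x v₀)) = fun i => CMTypeLattice.cmEmbedding (Φ i) (x i))
    {ζ : Π i, K i} (hζ : ∀ i, IsCMField.complexConj (K i) (ζ i) = -ζ i)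
    (hψ : ∀ x y : Π i, K i, c.act x v₀ ⬝ᵥ (typeFormOver δ ℚ *ᵥ c.act y v₀) =
        ∑ i, Algebra.trace ℚ (K i) (ζ i * x i * IsCMField.complexConj (K i) (y i)))
    (v w : Fin g ⊕ Fin g → ℝ) :
    v ⬝ᵥ (typeFormOver δ ℝ *ᵥ w) = ∑ i, CMTypeLattice.riemannForm (Φ i) (ζ i) (e v i) (e w i) := by
  -- both sides as real bilinear forms
  set L : LinearMap.BilinForm ℝ (Fin g ⊕ Fin g → ℝ) := Matrix.toBilin' (typeFormOver δ ℝ) with hL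
  set R : LinearMap.BilinForm ℝ (Fin g ⊕ Fin g → ℝ) :=
    ∑ i, (CMTypeLattice.riemannForm (Φ i) (ζ i)).comp ((LinearMap.proj i).comp e.toLinearMap)
      ((LinearMap.proj i).comp e.toLinearMap) with hR
  have hRapply : ∀ v w, R v w = ∑ i, CMTypeLattice.riemannForm (Φ i) (ζ i) (e v i) (e w i) := by
    intro v w
    simp only [hR, LinearMap.coe_sum, Finset.sum_apply, LinearMap.BilinForm.comp_apply, LinearMap.comp_apply,
      LinearMap.proj_apply, LinearEquiv.coe_coe]
  -- they agree on the rational points `act(x)·v₀`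
  have hrat : ∀ x y : Π i, K i,
      L ((algebraMap ℚ ℝ) ∘ (c.act x v₀)) ((algebraMap ℚ ℝ) ∘ (c.act y v₀)) =
        R ((algebraMap ℚ ℝ) ∘ (c.act x v₀)) ((algebraMap ℚ ℝ) ∘ (c.act y v₀)) := by
    intro x y
    rw [hRapply, hL, Matrix.toBilin'_apply', ← typeFormOver_map δ (algebraMap ℚ ℝ), map_mulVec_comp,
      ← RingHom.map_dotProduct, hψ, map_sum, he, he]
    refine Finset.sum_congr rfl fun i _ => ?_
    rw [CMTypeLattice.riemannForm_cmEmbedding (Φ i) (hζ i)]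
  -- every standard basis vector is a rational point
  have hbasis : ∀ k : Fin g ⊕ Fin g, ∃ x : Π i, K i,
      (Pi.basisFun ℝ (Fin g ⊕ Fin g) k : Fin g ⊕ Fin g → ℝ) = (algebraMap ℚ ℝ) ∘ (c.act x v₀) := by
    intro k
    obtain ⟨x, hx⟩ := hv₀.2 (Pi.single k 1)
    refine ⟨x, ?_⟩
    rw [Pi.basisFun_apply, show c.act x v₀ = Pi.single k 1 from hx]
    funext j
    by_cases hj : j = k
    · subst hj
      rw [Function.comp_apply, Pi.single_eq_same, Pi.single_eq_same, map_one]
    · rw [Function.comp_apply, Pi.single_eq_of_ne hj, Pi.single_eq_of_ne hj, map_zero]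
  have hLR : L = R := by
    refine LinearMap.BilinForm.ext_basis (Pi.basisFun ℝ (Fin g ⊕ Fin g)) fun k l => ?_
    obtain ⟨x, hx⟩ := hbasis k
    obtain ⟨y, hy⟩ := hbasis l
    rw [hx, hy]
    exact hrat x y
  have := LinearMap.congr_fun₂ hLR v w
  rw [hL, Matrix.toBilin'_apply'] at this
  rw [this, hRapply]

/-! ### §4. The sign: on the `𝔥_g`-half `X⁺` the trace-form element has `Im ζᵢ^φ < 0` (Shimura datum `−ζ`) -/

omit [∀ i, IsCMField (K i)] in
/-- **THE SIGN OF THE TRACE-FORM ELEMENT AT A SPECIAL PAIR.**  Let `e` be a chart as in §3 which moreover carries the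
complex structure `J` to `√−1` (`e(J·v) = √−1·e(v)`, ★ R60-33 `IsSpecial.exists_periodIso` (a)).  If `J ∈ X⁺ = C0 δ`
(Lange's half: `J² = −1`, `ᵗJ E_δ J = E_δ`, `ᵗJ E_δ ≻ 0`, i.e. `ψ_δ(Jv, v) > 0`) then `Im φ(ζᵢ) < 0` for every factor `i`
and every `φ ∈ Φᵢ`: test `ψ_δ(Ju, u) = Σᵢ E_{ζᵢ}(√−1·(e u)ᵢ, (e u)ᵢ) = −2 Σ_{i,φ} Im(ζᵢ^φ)|(e u)_{iφ}|²`
(★ `riemannForm_self_I_smul`) on `u = e⁻¹(δ_{iφ})`.  CONVENTIONS: Lange's positivity `E(J·, ·) ≻ 0` ([Lange2023] (7.1),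
the tree's `C0`) is Shimura's `E(·, √−1·) ≻ 0` ([Shimura1998] §6.2 Thm. 4 (4): `Im ζ^φ > 0`) for `−E`; so the Shimura
datum of the special point on `X⁺` is `(Kᵢ, Φᵢ; −ζᵢ)`, cf. `neg_im_pos_of_mem_C0` below. [cite: Shimura1998, §6.2 Thm. 4, p. 45]
[cite: Lange2023AbelianVarietiesComplex, §7.1.2 (7.1) (p0326–p0327)] [cite: Milne2005ShimuraVarieties, §6 pp. 68–70] -/
theorem im_embedding_neg_of_mem_C0 (Φ : ∀ i, CMType (K i))
    {J : Matrix (Fin g ⊕ Fin g) (Fin g ⊕ Fin g) ℝ} (hJ : J ∈ SiegelModuli.C0 δ)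
    (e : (Fin g ⊕ Fin g → ℝ) ≃ₗ[ℝ] (Π i, ((Φ i).1 → ℂ)))
    (ha : ∀ v, e (J *ᵥ v) = Complex.I • e v)
    {ζ : Π i, K i}
    (hψ : ∀ v w : Fin g ⊕ Fin g → ℝ,
      v ⬝ᵥ (typeFormOver δ ℝ *ᵥ w) = ∑ i, CMTypeLattice.riemannForm (Φ i) (ζ i) (e v i) (e w i))
    (i : ι) (φ : (Φ i).1) : (φ.1 (ζ i)).im < 0 := by
  -- the test vector `u = e⁻¹(δ_{iφ})`
  set u : Fin g ⊕ Fin g → ℝ := e.symm (Pi.single i (Pi.single φ 1)) with hu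
  have heu : e u = Pi.single i (Pi.single φ 1) := by rw [hu, LinearEquiv.apply_symm_apply]
  have hu0 : u ≠ 0 := by
    intro h0
    have : (Pi.single i (Pi.single φ (1 : ℂ)) : Π i, ((Φ i).1 → ℂ)) i φ = 0 := by
      rw [← heu, h0, map_zero]; rfl
    rw [Pi.single_eq_same, Pi.single_eq_same] at this
    exact one_ne_zero this
  -- Lange positivity: `0 < ψ_δ(Ju, u)`
  have hpos : 0 < (J *ᵥ u) ⬝ᵥ (typeFormOver δ ℝ *ᵥ u) := by
    have h := (SiegelModuli.mem_C0_iff.mp hJ).2.dotProduct_mulVec_pos hu0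
    rwa [star_trivial, ← typeFormOver_real_eq_realTypeForm, ← Matrix.mulVec_mulVec, Matrix.dotProduct_mulVec,
      Matrix.vecMul_transpose] at h
  -- `ψ_δ(Ju, u) = −2 Im(ζᵢ^φ)`
  rw [hψ, ha, heu] at hpos
  have hval : (∑ j, CMTypeLattice.riemannForm (Φ j) (ζ j) ((Complex.I • (Pi.single i (Pi.single φ (1 : ℂ)) :
      Π i, ((Φ i).1 → ℂ))) j) ((Pi.single i (Pi.single φ (1 : ℂ)) : Π i, ((Φ i).1 → ℂ)) j)) =
      -(2 * (φ.1 (ζ i)).im) := by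
    rw [Finset.sum_eq_single i (fun j _ hj => by
        rw [Pi.smul_apply, Pi.single_eq_of_ne hj, smul_zero, LinearMap.BilinForm.zero_left])
      (fun h => (h (Finset.mem_univ i)).elim),
      Pi.smul_apply, Pi.single_eq_same, CMTypeLattice.riemannForm_swap, CMTypeLattice.riemannForm_self_I_smul,
      Finset.sum_eq_single φ (fun ψ _ hψ => by rw [Pi.single_eq_of_ne hψ, map_zero, mul_zero])
      (fun h => (h (Finset.mem_univ φ)).elim), Pi.single_eq_same, map_one, mul_one]
  rw [hval] at hpos
  linarith

omit [∀ i, IsCMField (K i)] in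
/-- **The Shimura datum of the `𝔥_g`-half is `−ζ`**: under the hypotheses of `im_embedding_neg_of_mem_C0`,
`0 < Im φ(−ζᵢ)` for all `i` and `φ ∈ Φᵢ` — so `(Kᵢ, Φᵢ; −ζᵢ)` satisfies the Riemann-form condition of
[Shimura1998] §6.2 Thm. 4 (4) («`Im(ζ^{φᵢ}) > 0`»), and `ψ_δ(v, w) = Σᵢ E_{−ζᵢ}((e w)ᵢ, (e v)ᵢ)` (`E_{−ζ} = −E_ζ`, ★ `riemannForm_swap`).
[cite: Shimura1998, §6.2 Thm. 4, p. 45] [cite: Lange2023AbelianVarietiesComplex, §7.1.2 (7.1) (p0326–p0327)] -/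
theorem neg_im_pos_of_mem_C0 (Φ : ∀ i, CMType (K i))
    {J : Matrix (Fin g ⊕ Fin g) (Fin g ⊕ Fin g) ℝ} (hJ : J ∈ SiegelModuli.C0 δ)
    (e : (Fin g ⊕ Fin g → ℝ) ≃ₗ[ℝ] (Π i, ((Φ i).1 → ℂ)))
    (ha : ∀ v, e (J *ᵥ v) = Complex.I • e v)
    {ζ : Π i, K i}
    (hψ : ∀ v w : Fin g ⊕ Fin g → ℝ,
      v ⬝ᵥ (typeFormOver δ ℝ *ᵥ w) = ∑ i, CMTypeLattice.riemannForm (Φ i) (ζ i) (e v i) (e w i))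
    (i : ι) (φ : (Φ i).1) : 0 < (φ.1 (-ζ i)).im := by
  rw [map_neg, Complex.neg_im, neg_pos]
  exact im_embedding_neg_of_mem_C0 Φ hJ e ha hψ i φ

omit [∀ i, IsCMField (K i)] in
/-- On the other half `X⁻` (`−J ∈ C0 δ`) the sign flips: `0 < Im φ(ζᵢ)`. [cite: Shimura1998, §6.2 Thm. 4, p. 45]
[cite: Milne2005ShimuraVarieties, §6 pp. 68–70] -/
theorem im_embedding_pos_of_neg_mem_C0 (Φ : ∀ i, CMType (K i))
    {J : Matrix (Fin g ⊕ Fin g) (Fin g ⊕ Fin g) ℝ} (hJ : -J ∈ SiegelModuli.C0 δ)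
    (e : (Fin g ⊕ Fin g → ℝ) ≃ₗ[ℝ] (Π i, ((Φ i).1 → ℂ)))
    (ha : ∀ v, e (J *ᵥ v) = Complex.I • e v)
    {ζ : Π i, K i}
    (hψ : ∀ v w : Fin g ⊕ Fin g → ℝ,
      v ⬝ᵥ (typeFormOver δ ℝ *ᵥ w) = ∑ i, CMTypeLattice.riemannForm (Φ i) (ζ i) (e v i) (e w i))
    (i : ι) (φ : (Φ i).1) : 0 < (φ.1 (ζ i)).im := by
  -- `−J` is carried to `√−1` by the conjugate chart `v ↦ conj (e v)`... instead: apply §4 to `−J` and `−ζ` with the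
  -- chart `e' = conj ∘ e`? Simpler: `ψ_δ((−J)u, u) > 0` gives `+2 Im ζ > 0` by the same computation.
  set u : Fin g ⊕ Fin g → ℝ := e.symm (Pi.single i (Pi.single φ 1)) with hu
  have heu : e u = Pi.single i (Pi.single φ 1) := by rw [hu, LinearEquiv.apply_symm_apply]
  have hu0 : u ≠ 0 := by
    intro h0
    have : (Pi.single i (Pi.single φ (1 : ℂ)) : Π i, ((Φ i).1 → ℂ)) i φ = 0 := by
      rw [← heu, h0, map_zero]; rfl
    rw [Pi.single_eq_same, Pi.single_eq_same] at this
    exact one_ne_zero this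
  have hpos : 0 < ((-J) *ᵥ u) ⬝ᵥ (typeFormOver δ ℝ *ᵥ u) := by
    have h := (SiegelModuli.mem_C0_iff.mp hJ).2.dotProduct_mulVec_pos hu0
    rwa [star_trivial, ← typeFormOver_real_eq_realTypeForm, ← Matrix.mulVec_mulVec, Matrix.dotProduct_mulVec,
      Matrix.vecMul_transpose] at h
  rw [Matrix.neg_mulVec, neg_dotProduct, hψ, ha, heu] at hpos
  have hval : (∑ j, CMTypeLattice.riemannForm (Φ j) (ζ j) ((Complex.I • (Pi.single i (Pi.single φ (1 : ℂ)) :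
      Π i, ((Φ i).1 → ℂ))) j) ((Pi.single i (Pi.single φ (1 : ℂ)) : Π i, ((Φ i).1 → ℂ)) j)) =
      -(2 * (φ.1 (ζ i)).im) := by
    rw [Finset.sum_eq_single i (fun j _ hj => by
        rw [Pi.smul_apply, Pi.single_eq_of_ne hj, smul_zero, LinearMap.BilinForm.zero_left])
      (fun h => (h (Finset.mem_univ i)).elim),
      Pi.smul_apply, Pi.single_eq_same, CMTypeLattice.riemannForm_swap, CMTypeLattice.riemannForm_self_I_smul,
      Finset.sum_eq_single φ (fun ψ _ hψ => by rw [Pi.single_eq_of_ne hψ, map_zero, mul_zero])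
      (fun h => (h (Finset.mem_univ φ)).elim), Pi.single_eq_same, map_one, mul_one]
  rw [hval] at hpos
  linarith

/-! ### §5. HEAD: the polarised period isomorphism of a special pair -/

/-- **THE POLARISED PERIOD ISOMORPHISM OF A CM SPECIAL PAIR** — R60-33 ★ `IsSpecial.exists_periodIso` together with
§2–§4: for a special pair `(c, J, Φ)` on the Siegel datum there are an `ℝ`-linear isomorphism `e : ℝ^{2g} ≃ ∏ᵢ ℂ^{Φᵢ}`,
a cyclic vector `v₀` and `ζ = (ζᵢ) ∈ F = ∏ Kᵢ` with `ζ̄ = −ζ` such that (a) `e(J·v) = √−1·e(v)`; (b) `e(act(x)·v) = Ψ(x)·e(v)`;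
(c) `x ↦ act(x)·v₀` is a bijection `F → ℚ^{2g}` and `e(act(x)·v₀) = Ψ(x)`; (d) the polarisation is the trace form:
`ψ_δ(v, w) = Σᵢ E_{ζᵢ}((e v)ᵢ, (e w)ᵢ)` with `E_ζ(u(a), u(b)) = Tr(ζ a b̄)` (★ `CMTypeLattice.riemannForm`); (e) the sign:
`Im φ(ζᵢ) < 0` on `X⁺` (`J ∈ C0 δ`) and `> 0` on `X⁻` (`−J ∈ C0 δ`) for all `i`, `φ ∈ Φᵢ`.  I.e. the polarised special point
`(ℝ^{2g}, J, ψ_δ, act ⊃ ℚ^{2g})` IS the CM datum `(∏ᵢ ℂ^{Φᵢ}, √−1, Σᵢ E_{ζᵢ}, F)` of [Shimura1998] §6.2 Thm. 4 with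
`(Kᵢ, Φᵢ; ∓ζᵢ)` a Riemann-form datum (`Im(∓ζᵢ)^φ > 0`), the object [Deligne1971TravauxShimura] 4.19–4.21 feeds to
Shimura–Taniyama. [cite: Shimura1998, §6.2 Thm. 4, p. 45] [cite: Deligne1971TravauxShimura, 4.18 p. 150]
[cite: Milne2005ShimuraVarieties, Ex. 12.4 (b) p. 112; §6 pp. 68–70] -/
theorem IsSpecial.exists_periodIso_riemannForm {c : CMStructure g δ ι K} {J : C0pm δ} {Φ : ∀ i, CMType (K i)}
    (h : c.IsSpecial J Φ) :
    ∃ (e : (Fin g ⊕ Fin g → ℝ) ≃ₗ[ℝ] (Π i, ((Φ i).1 → ℂ))) (v₀ : Fin g ⊕ Fin g → ℚ) (ζ : Π i, K i),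
      (∀ v, e ((J : Matrix (Fin g ⊕ Fin g) (Fin g ⊕ Fin g) ℝ) *ᵥ v) = Complex.I • e v) ∧
      (∀ (x : Π i, K i) (v : Fin g ⊕ Fin g → ℝ),
        e ((c.actMatrix x).map (algebraMap ℚ ℝ) *ᵥ v) = (fun i => CMTypeLattice.cmEmbedding (Φ i) (x i)) * e v) ∧
      Function.Bijective (fun x : Π i, K i => c.act x v₀) ∧
      (∀ x : Π i, K i, e ((algebraMap ℚ ℝ) ∘ (c.act x v₀)) = fun i => CMTypeLattice.cmEmbedding (Φ i) (x i)) ∧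
      (∀ i, IsCMField.complexConj (K i) (ζ i) = -ζ i) ∧
      (∀ v w : Fin g ⊕ Fin g → ℝ,
        v ⬝ᵥ (typeFormOver δ ℝ *ᵥ w) = ∑ i, CMTypeLattice.riemannForm (Φ i) (ζ i) (e v i) (e w i)) ∧
      ((J : Matrix (Fin g ⊕ Fin g) (Fin g ⊕ Fin g) ℝ) ∈ SiegelModuli.C0 δ → ∀ (i : ι) (φ : (Φ i).1), (φ.1 (ζ i)).im < 0) ∧
      (-(J : Matrix (Fin g ⊕ Fin g) (Fin g ⊕ Fin g) ℝ) ∈ SiegelModuli.C0 δ → ∀ (i : ι) (φ : (Φ i).1), 0 < (φ.1 (ζ i)).im) := by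
  obtain ⟨e, ha, hb, v₀, hv₀, hc⟩ := h.exists_periodIso
  obtain ⟨ζ, hζ, hψ⟩ := c.exists_skew_trace_eq_typeForm v₀
  have hform := c.dotProduct_typeFormOver_mulVec_eq_sum_riemannForm Φ e hv₀ hc hζ hψ
  exact ⟨e, v₀, ζ, ha, hb, hv₀, hc, hζ, hform, fun hJ => im_embedding_neg_of_mem_C0 Φ hJ e ha hform,
    fun hJ => im_embedding_pos_of_neg_mem_C0 Φ hJ e ha hform⟩

end CMStructure

end Literature.AlgebraicGeometry.ModuliOfAbelianVarieties

end
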